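import Mathlib
import HarnessLib
import Summits.HubbardSuperconductivity.HubbardSuperconductivity.Theorems.KLProgrammeC4aPartnerBandTangencyDefectPh

/-!
# Route `KLProgramme` — crux C4a, S3 brick (B2, TANGENCY, ORDER 0): the VALUE of the partner band near the tangency configurations is `O(φ² + |e| + |ρ| + |ϑ − ϑ_T|)`
# (pp: `ϑ_T = 0`; ph: `ϑ_T = π`)

Cell `gate-hubbard-kl`, lane hubbard-kl-c4a-1 (g6); helper for stub (C) `stub_twoLeg_curvature` of the engine-flow child `KLRegimeEngineV17F2`
(stmt-HubbardSuperconductivity-20437); memo HOME/hubbard-kl-c4a-1/C4A-PLAN.md §24.4 (ii), §24.8.  The order-0 companion of `…C4aPartnerBandTangencyDefect(Ph/Two/TwoPh)`: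
with `a = Γ(θ)`, `b = Γ′(θ)` and `ψ₀(x) := f(a − xb)` one has `ψ₀(0) = f(a) = 0`, `ψ₀′(0) = −Df(a)[b] = −(f∘Γ)′(θ) = 0`, `|ψ₀″| ≤ K₂D₁²`, and
`ē(0,φ;T) = f(a − φb − R₀)` with `‖R₀‖ ≤ D₂φ²`.  (The sharper expansion `ē = −e + b_T(θ)φ² + …` with the curvature coefficient `b_T = D²e_K(Γ)[Γ′,Γ′]` is (B4)-(T)'s input
and needs a certified curvature row — memo §24.8 (i); here only the `O(|e|)` form.)

* `abs_tangency_core_zero_le` — `|f(Γ(θ) + Γ(θ) − Γ(φ+θ))| ≤ (K₂D₁² + K₁D₂)·φ²` for `Γ` in the zero level of `f`;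
* **`abs_partnerBand_pp_tangency_le`** — `|e_K(S_{ρ,ϑ,θ}(0) − Φ(e,φ+θ))| ≤ (K₂D₁² + K₁D₂)φ² + K₁|e|/d + K₁(|ρ|/d + D₁|ϑ|)`;
* **`abs_partnerBand_ph_tangency_le`** — `|e_K(Φ(e,φ+θ) − D_{ρ,ϑ,θ}(0))| ≤ (K₂D₁² + K₁D₂)φ² + K₁|e|/d + K₁(|ρ|/d + D₁|ϑ − π|)`.

Pure calculus on landed objects; nothing about the model's sizes; nothing asserts superconductivity.  References: FST II CPAM 51 (1998) §3; BGM 2006 §2.4 (2.40) [cite: BenfattoGiulianiMastropietro2006].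
-/

noncomputable section

namespace Summit.HubbardSuperconductivity.HubbardSuperconductivity.Theorems.C4a

set_option linter.dupNamespace false -- summit = problem name (single-conjunct summit), D-0017

open Real Set Filter
open scoped Topology
open Literature.MathematicalPhysics.QuantumLattice Literature.MathematicalPhysics.QuantumLattice.BandSectorCounting Literature.Probability.LatticeModels
open Summit.HubbardSuperconductivity.HubbardSuperconductivity.Theorems.KLRegimeSplit
open Summit.HubbardSuperconductivity.HubbardSuperconductivity.Theorems.DispersionFlow
open Summit.HubbardSuperconductivity.HubbardSuperconductivity.Theorems.PerturbedFermiCurve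

section Abstract

variable {V : Type*} [NormedAddCommGroup V] [NormedSpace ℝ V]

/-- **THE TANGENCY CORE AT ORDER 0**: for `f ∈ C⁴` with `‖Df‖ ≤ K₁`, `‖D²f‖ ≤ K₂`, a `C⁴` curve `Γ` in the zero level of `f` with `‖Γ′‖ ≤ D₁`, `‖Γ″‖ ≤ D₂`, and all `θ, φ`:
`|f(Γ(θ) + Γ(θ) − Γ(φ+θ))| ≤ (K₂D₁² + K₁D₂)·φ²`. -/
theorem abs_tangency_core_zero_le {f : V → ℝ} (hf : ContDiff ℝ 4 f) {K₁ K₂ : ℝ} (hK₁ : ∀ x, ‖fderiv ℝ f x‖ ≤ K₁) (hK₂ : ∀ x, ‖iteratedFDeriv ℝ 2 f x‖ ≤ K₂)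
    {Γ : ℝ → V} (hΓ : ContDiff ℝ 4 Γ) (hΓ0 : ∀ s, f (Γ s) = 0) {D₁ D₂ : ℝ} (hD₁ : ∀ s, ‖iteratedDeriv 1 Γ s‖ ≤ D₁) (hD₂ : ∀ s, ‖iteratedDeriv 2 Γ s‖ ≤ D₂)
    (θ φ : ℝ) : |f (Γ θ + Γ θ - Γ (φ + θ))| ≤ (K₂ * D₁ ^ 2 + K₁ * D₂) * φ ^ 2 := by
  have hK₁0 : 0 ≤ K₁ := (norm_nonneg _).trans (hK₁ 0)
  have hK₂0 : 0 ≤ K₂ := (norm_nonneg _).trans (hK₂ 0)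
  have hD₁0 : 0 ≤ D₁ := (norm_nonneg _).trans (hD₁ 0)
  have hΓd : ∀ s, HasDerivAt Γ (iteratedDeriv 1 Γ s) s := fun s => by
    have h := hasDerivAt_iteratedDeriv_of_contDiff_four hΓ (show 0 < 4 by norm_num) s
    rwa [iteratedDeriv_zero] at h
  have hΓ1d : ∀ s, HasDerivAt (iteratedDeriv 1 Γ) (iteratedDeriv 2 Γ s) s := fun s =>
    hasDerivAt_iteratedDeriv_of_contDiff_four hΓ (show 1 < 4 by norm_num) s
  have hfd : Differentiable ℝ f := hf.differentiable (by norm_num)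
  have hf1d : Differentiable ℝ (fderiv ℝ f) := (hf.fderiv_right (m := 3) (by norm_num)).differentiable (by norm_num)
  have hconst : f ∘ Γ = fun _ => (0 : ℝ) := funext fun s => hΓ0 s
  have hc1 : fderiv ℝ f (Γ θ) (iteratedDeriv 1 Γ θ) = 0 := by
    rw [← iteratedDeriv_one_comp_eq hf hΓ θ, hconst, iteratedDeriv_const]; simp
  have hR₀n : ‖Γ (φ + θ) - Γ θ - φ • iteratedDeriv 1 Γ θ‖ ≤ D₂ * φ ^ 2 := by
    have h := norm_sub_sub_smul_le_sq (g := fun x : ℝ => Γ (x + θ)) (g₁ := fun x : ℝ => iteratedDeriv 1 Γ (x + θ))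
      (g₂ := fun x : ℝ => iteratedDeriv 2 Γ (x + θ)) (fun x => HasDerivAt.comp_add_const x θ (hΓd (x + θ)))
      (fun x => HasDerivAt.comp_add_const x θ (hΓ1d (x + θ))) (φ := φ) (M := D₂) (fun x _ => hD₂ (x + θ))
    simpa only [zero_add] using h
  set a := Γ θ with ha
  set b := iteratedDeriv 1 Γ θ with hb
  set R₀ := Γ (φ + θ) - a - φ • b with hR₀
  have hbn : ‖b‖ ≤ D₁ := hD₁ θ
  have e0 : a + a - Γ (φ + θ) = (a - φ • b) - R₀ := by rw [hR₀]; abel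
  rw [e0]
  -- `ψ₀(x) = f(a − xb)`
  have hl : ∀ x : ℝ, HasDerivAt (fun y : ℝ => a - y • b) (-b) x := fun x =>
    (((hasDerivAt_id' x).smul_const b).const_sub a).congr_deriv (by rw [one_smul])
  have hψd : ∀ x : ℝ, HasDerivAt (fun y : ℝ => f (a - y • b)) (fderiv ℝ f (a - x • b) (-b)) x := fun x =>
    (hfd _).hasFDerivAt.comp_hasDerivAt_of_eq x (hl x) rfl
  have hψ₁d : ∀ x : ℝ, HasDerivAt (fun y : ℝ => fderiv ℝ f (a - y • b) (-b)) (fderiv ℝ (fderiv ℝ f) (a - x • b) (-b) (-b)) x := fun x =>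
    (((hf1d _).hasFDerivAt.comp_hasDerivAt_of_eq x (hl x) rfl).clm_apply (hasDerivAt_const x (-b))).congr_deriv (by rw [map_zero, add_zero])
  have hψ0 : (fun y : ℝ => f (a - y • b)) 0 = 0 := by
    show f (a - (0 : ℝ) • b) = 0
    rw [zero_smul, sub_zero, ha]; exact hΓ0 θ
  have hψ₁0 : (fun y : ℝ => fderiv ℝ f (a - y • b) (-b)) 0 = 0 := by
    show fderiv ℝ f (a - (0 : ℝ) • b) (-b) = 0
    rw [zero_smul, sub_zero, map_neg, hc1, neg_zero]
  have hψ₂n : ∀ x : ℝ, |x| ≤ |φ| → |fderiv ℝ (fderiv ℝ f) (a - x • b) (-b) (-b)| ≤ K₂ * D₁ ^ 2 := fun x _ => by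
    have hL₂ : ‖fderiv ℝ (fderiv ℝ f) (a - x • b)‖ ≤ K₂ := by rw [norm_fderiv_two_eq_norm_iteratedFDeriv]; exact hK₂ _
    have hnb : ‖-b‖ ≤ D₁ := by rw [norm_neg]; exact hbn
    rw [← Real.norm_eq_abs]
    refine ((fderiv ℝ (fderiv ℝ f) (a - x • b)).le_opNorm₂ (-b) (-b)).trans ?_
    calc ‖fderiv ℝ (fderiv ℝ f) (a - x • b)‖ * ‖-b‖ * ‖-b‖ ≤ K₂ * D₁ * D₁ := by gcongr
      _ = K₂ * D₁ ^ 2 := by ring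
  have hψ : |f (a - φ • b)| ≤ K₂ * D₁ ^ 2 * φ ^ 2 := abs_le_sq_of_hasDerivAt_two hψd hψ₁d hψ0 hψ₁0 hψ₂n
  -- the remainder correction
  have hLip : |f (a - φ • b - R₀) - f (a - φ • b)| ≤ K₁ * (D₂ * φ ^ 2) := by
    have h := (convex_univ (𝕜 := ℝ) (E := V)).norm_image_sub_le_of_norm_fderiv_le (𝕜 := ℝ) (f := f) (fun z _ => hfd z) (fun z _ => hK₁ z)
      (mem_univ (a - φ • b)) (mem_univ (a - φ • b - R₀))
    rw [show a - φ • b - R₀ - (a - φ • b) = -R₀ by abel, norm_neg, Real.norm_eq_abs] at h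
    exact h.trans (mul_le_mul_of_nonneg_left hR₀n hK₁0)
  have := abs_sub_abs_le_abs_sub (f (a - φ • b - R₀)) (f (a - φ • b))
  linarith

end Abstract

section Sizes

variable {K : TrigPolyC4v} {A : ℝ} (hA : ∀ p : Momentum, ∀ j ≤ 2, ‖iteratedFDeriv ℝ j (frameShift K) p‖ ≤ A) (hA20 : A ≤ 1 / 20)
  (hd : klCurveD ≤ (bandBounds (show (-4 : ℝ) < -1.1 by norm_num) (show (-1.1 : ℝ) ≤ -0.1 by norm_num)
    (show (-0.1 : ℝ) < 0 by norm_num)).Dtmin - 2 * A)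
  {μ r : ℝ} (hr : 0 < r) (hlo : (-1.1 : ℝ) < μ - r - A) (hhi : μ + r + A < -0.1)
  {A₃ A₄ : ℝ} (hA₃ : ∀ p : Momentum, ‖iteratedFDeriv ℝ 3 (frameShift K) p‖ ≤ A₃)
  (hA₄ : ∀ p : Momentum, ‖iteratedFDeriv ℝ 4 (frameShift K) p‖ ≤ A₄)
  {K₁ K₂ : ℝ} (hK₁ : ∀ p : Momentum, ‖fderiv ℝ (frameLevel μ K) p‖ ≤ K₁) (hK₂ : ∀ p : Momentum, ‖iteratedFDeriv ℝ 2 (frameLevel μ K) p‖ ≤ K₂)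
include hA hA20 hd hr hlo hhi hA₃ hA₄ hK₁ hK₂

/-- **THE VALUE OF THE pp PARTNER BAND NEAR TANGENCY**: `|e_K(S_{ρ,ϑ,θ}(0) − Φ(e, φ+θ))| ≤ (K₂D₁² + K₁D₂)·φ² + K₁·|e|/d + K₁·(|ρ|/d + D₁|ϑ|)`. -/
theorem abs_partnerBand_pp_tangency_le {ρ : ℝ} (hρ : |ρ| < r) {e : ℝ} (he : |e| < r) (ϑ θ φ : ℝ) :
    |frameLevel μ K (pairSumPath μ K ρ ϑ θ 0 - levelPoint μ K e (φ + θ))| ≤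
      (K₂ * msD A₃ A₄ 1 ^ 2 + K₁ * msD A₃ A₄ 2) * φ ^ 2 + K₁ * (|e| / ((bandBounds (show (-4 : ℝ) < -1.1 by norm_num) (show (-1.1 : ℝ) ≤ -0.1 by norm_num) (show (-0.1 : ℝ) < 0 by norm_num)).Dtmin - 2 * A)) +
        K₁ * (|ρ| / ((bandBounds (show (-4 : ℝ) < -1.1 by norm_num) (show (-1.1 : ℝ) ≤ -0.1 by norm_num) (show (-0.1 : ℝ) < 0 by norm_num)).Dtmin - 2 * A) + msD A₃ A₄ 1 * |ϑ|) := by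
  set B₀ := bandBounds (show (-4 : ℝ) < -1.1 by norm_num) (show (-1.1 : ℝ) ≤ -0.1 by norm_num) (show (-0.1 : ℝ) < 0 by norm_num) with hB₀
  have hADt : 2 * A < B₀.Dtmin := by have := klCurveD_pos; linarith
  have h0 : |(0 : ℝ)| < r := by simpa using hr
  have hK₁0 : 0 ≤ K₁ := (norm_nonneg _).trans (hK₁ 0)
  have hf : ContDiff ℝ 4 (frameLevel μ K) := EngineV8.contDiff_frameLevel μ K
  -- STEP 1: `e → 0`
  have step1 : |frameLevel μ K (pairSumPath μ K ρ ϑ θ 0 - levelPoint μ K e (φ + θ)) - frameLevel μ K (pairSumPath μ K ρ ϑ θ 0 - levelPoint μ K 0 (φ + θ))| ≤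
      K₁ * (|e| / (B₀.Dtmin - 2 * A)) := by
    refine (abs_frameLevel_sub_le hK₁ _ _).trans (mul_le_mul_of_nonneg_left ?_ hK₁0)
    rw [show pairSumPath μ K ρ ϑ θ 0 - levelPoint μ K e (φ + θ) - (pairSumPath μ K ρ ϑ θ 0 - levelPoint μ K 0 (φ + θ)) =
      -(levelPoint μ K e (φ + θ) - levelPoint μ K 0 (φ + θ)) by abel, norm_neg]
    have h := norm_levelPoint_sub_levelPoint_le B₀ hA hADt hlo hhi (ρ := e) (ρ' := 0) ⟨(abs_lt.1 he).1, (abs_lt.1 he).2⟩ ⟨by linarith, hr⟩ (φ + θ)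
    rwa [sub_zero] at h
  -- STEP 2: `(ρ, ϑ) → (0, 0)`
  have step2 : |frameLevel μ K (pairSumPath μ K ρ ϑ θ 0 - levelPoint μ K 0 (φ + θ)) - frameLevel μ K (pairSumPath μ K 0 0 θ 0 - levelPoint μ K 0 (φ + θ))| ≤
      K₁ * (|ρ| / (B₀.Dtmin - 2 * A) + msD A₃ A₄ 1 * |ϑ|) := by
    refine (abs_frameLevel_sub_le hK₁ _ _).trans (mul_le_mul_of_nonneg_left ?_ hK₁0)
    rw [show pairSumPath μ K ρ ϑ θ 0 - levelPoint μ K 0 (φ + θ) - (pairSumPath μ K 0 0 θ 0 - levelPoint μ K 0 (φ + θ)) = -pairDiffPath μ K ρ ϑ θ 0 by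
      simp only [pairSumPath, pairDiffPath, zero_add, add_zero]; abel, norm_neg]
    exact norm_pairDiffPath_zero_le hA hA20 hd hr hlo hhi hA₃ hA₄ hρ ϑ θ
  -- STEP 3: the core
  have step3 : |frameLevel μ K (pairSumPath μ K 0 0 θ 0 - levelPoint μ K 0 (φ + θ))| ≤ (K₂ * msD A₃ A₄ 1 ^ 2 + K₁ * msD A₃ A₄ 2) * φ ^ 2 := by
    rw [show pairSumPath μ K 0 0 θ 0 = levelPoint μ K 0 θ + levelPoint μ K 0 θ by simp only [pairSumPath, zero_add, add_zero]]
    exact abs_tangency_core_zero_le hf hK₁ hK₂ (contDiff_levelPoint_angle B₀ hA hADt hlo hhi h0) (fun s => frameLevel_levelPoint_zero B₀ hA hr hlo hhi s)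
      (fun s => norm_iteratedDeriv_levelPoint_le hA hA20 hd hlo hhi hA₃ hA₄ h0 le_rfl (by norm_num) s)
      (fun s => norm_iteratedDeriv_levelPoint_le hA hA20 hd hlo hhi hA₃ hA₄ h0 (i := 2) (by norm_num) (by norm_num) s) θ φ
  have tri := abs_sub_abs_le_abs_sub (frameLevel μ K (pairSumPath μ K ρ ϑ θ 0 - levelPoint μ K e (φ + θ)))
    (frameLevel μ K (pairSumPath μ K ρ ϑ θ 0 - levelPoint μ K 0 (φ + θ)))
  have tri' := abs_sub_abs_le_abs_sub (frameLevel μ K (pairSumPath μ K ρ ϑ θ 0 - levelPoint μ K 0 (φ + θ)))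
    (frameLevel μ K (pairSumPath μ K 0 0 θ 0 - levelPoint μ K 0 (φ + θ)))
  linarith

/-- **THE VALUE OF THE ph PARTNER BAND NEAR `2k_F`**: `|e_K(Φ(e, φ+θ) − D_{ρ,ϑ,θ}(0))| ≤ (K₂D₁² + K₁D₂)·φ² + K₁·|e|/d + K₁·(|ρ|/d + D₁|ϑ − π|)`. -/
theorem abs_partnerBand_ph_tangency_le {ρ : ℝ} (hρ : |ρ| < r) {e : ℝ} (he : |e| < r) (ϑ θ φ : ℝ) :
    |frameLevel μ K (levelPoint μ K e (φ + θ) - pairDiffPath μ K ρ ϑ θ 0)| ≤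
      (K₂ * msD A₃ A₄ 1 ^ 2 + K₁ * msD A₃ A₄ 2) * φ ^ 2 + K₁ * (|e| / ((bandBounds (show (-4 : ℝ) < -1.1 by norm_num) (show (-1.1 : ℝ) ≤ -0.1 by norm_num) (show (-0.1 : ℝ) < 0 by norm_num)).Dtmin - 2 * A)) +
        K₁ * (|ρ| / ((bandBounds (show (-4 : ℝ) < -1.1 by norm_num) (show (-1.1 : ℝ) ≤ -0.1 by norm_num) (show (-0.1 : ℝ) < 0 by norm_num)).Dtmin - 2 * A) + msD A₃ A₄ 1 * |ϑ - π|) := by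
  set B₀ := bandBounds (show (-4 : ℝ) < -1.1 by norm_num) (show (-1.1 : ℝ) ≤ -0.1 by norm_num) (show (-0.1 : ℝ) < 0 by norm_num) with hB₀
  have hADt : 2 * A < B₀.Dtmin := by have := klCurveD_pos; linarith
  have h0 : |(0 : ℝ)| < r := by simpa using hr
  have hK₁0 : 0 ≤ K₁ := (norm_nonneg _).trans (hK₁ 0)
  have hf : ContDiff ℝ 4 (frameLevel μ K) := EngineV8.contDiff_frameLevel μ K
  -- STEP 1: `e → 0`
  have step1 : |frameLevel μ K (levelPoint μ K e (φ + θ) - pairDiffPath μ K ρ ϑ θ 0) - frameLevel μ K (levelPoint μ K 0 (φ + θ) - pairDiffPath μ K ρ ϑ θ 0)| ≤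
      K₁ * (|e| / (B₀.Dtmin - 2 * A)) := by
    refine (abs_frameLevel_sub_le hK₁ _ _).trans (mul_le_mul_of_nonneg_left ?_ hK₁0)
    rw [show levelPoint μ K e (φ + θ) - pairDiffPath μ K ρ ϑ θ 0 - (levelPoint μ K 0 (φ + θ) - pairDiffPath μ K ρ ϑ θ 0) =
      levelPoint μ K e (φ + θ) - levelPoint μ K 0 (φ + θ) by abel]
    have h := norm_levelPoint_sub_levelPoint_le B₀ hA hADt hlo hhi (ρ := e) (ρ' := 0) ⟨(abs_lt.1 he).1, (abs_lt.1 he).2⟩ ⟨by linarith, hr⟩ (φ + θ)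
    rwa [sub_zero] at h
  -- STEP 2: `(ρ, ϑ) → (0, π)`
  have step2 : |frameLevel μ K (levelPoint μ K 0 (φ + θ) - pairDiffPath μ K ρ ϑ θ 0) - frameLevel μ K (levelPoint μ K 0 (φ + θ) - pairDiffPath μ K 0 π θ 0)| ≤
      K₁ * (|ρ| / (B₀.Dtmin - 2 * A) + msD A₃ A₄ 1 * |ϑ - π|) := by
    refine (abs_frameLevel_sub_le hK₁ _ _).trans (mul_le_mul_of_nonneg_left ?_ hK₁0)
    rw [show levelPoint μ K 0 (φ + θ) - pairDiffPath μ K ρ ϑ θ 0 - (levelPoint μ K 0 (φ + θ) - pairDiffPath μ K 0 π θ 0) = pairSumPath μ K ρ ϑ θ 0 by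
      rw [← pairDiffPath_pi_sub_eq_pairSumPath]; abel]
    exact norm_pairSumPath_zero_le hA hA20 hd hr hlo hhi hA₃ hA₄ hρ ϑ θ
  -- STEP 3: the core (`e_K` even)
  have step3 : |frameLevel μ K (levelPoint μ K 0 (φ + θ) - pairDiffPath μ K 0 π θ 0)| ≤ (K₂ * msD A₃ A₄ 1 ^ 2 + K₁ * msD A₃ A₄ 2) * φ ^ 2 := by
    rw [pairDiffPath_tangency, add_zero, show levelPoint μ K 0 (φ + θ) - (levelPoint μ K 0 θ + levelPoint μ K 0 θ) =
      -(levelPoint μ K 0 θ + levelPoint μ K 0 θ - levelPoint μ K 0 (φ + θ)) by abel, frameLevel_neg]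
    exact abs_tangency_core_zero_le hf hK₁ hK₂ (contDiff_levelPoint_angle B₀ hA hADt hlo hhi h0) (fun s => frameLevel_levelPoint_zero B₀ hA hr hlo hhi s)
      (fun s => norm_iteratedDeriv_levelPoint_le hA hA20 hd hlo hhi hA₃ hA₄ h0 le_rfl (by norm_num) s)
      (fun s => norm_iteratedDeriv_levelPoint_le hA hA20 hd hlo hhi hA₃ hA₄ h0 (i := 2) (by norm_num) (by norm_num) s) θ φ
  have tri := abs_sub_abs_le_abs_sub (frameLevel μ K (levelPoint μ K e (φ + θ) - pairDiffPath μ K ρ ϑ θ 0))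
    (frameLevel μ K (levelPoint μ K 0 (φ + θ) - pairDiffPath μ K ρ ϑ θ 0))
  have tri' := abs_sub_abs_le_abs_sub (frameLevel μ K (levelPoint μ K 0 (φ + θ) - pairDiffPath μ K ρ ϑ θ 0))
    (frameLevel μ K (levelPoint μ K 0 (φ + θ) - pairDiffPath μ K 0 π θ 0))
  linarith

end Sizes

end Summit.HubbardSuperconductivity.HubbardSuperconductivity.Theorems.C4a

end
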